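import Summits.BirchSwinnertonDyer.Rank1Residual.AdditivePotMult.QuadraticBaseChangeOddTamagawaDictionary
import Literature.NumberTheory.EllipticCurves.ComplexMultiplicationDeuringLocalPlaces
import Literature.NumberTheory.Congruences.QuadraticCharactersMinusThreeAndFive
import Literature.NumberTheory.QuadraticFields.KroneckerSplitting
import Literature.NumberTheory.EllipticCurves.ShortWeierstrassGoodTwistLocalProofs
import HarnessLib

/-!
# PART I MEANING, places half — the places of inertia degree `2` of a quadratic field with
# `d_K = −3` (cell `bsd-print-cfram`, typer seat `ty3`; companion of `X12/CMRamifiedRecordSchemaI.lean`)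

HONEST FRAMING (cell `bsd-print-cfram`, run/shared/lean/pub/bsd-print-cfram/, verbatim in every file
of the cell): PARTITION currency only — the leaf counts when its class theorem is in the kernel BY
NAME, flag-free; Literature named facts are statement-only with cite tags, never sorried theorems;
every imported theorem carries its printed hypotheses verbatim; numbers, not adjectives. THIS FILE:
THEOREMS ONLY (no definition, no named fact, no `sorry`); elementary algebraic number theory of
`K = ℚ(√−3)` in the tree's place currency; nothing about BSD is asserted or booked; no mark moves.

## What is here (`K` a number field with `[K : ℚ] = 2` and `d_K = −3`)

The decomposition law of `ℚ(√−3)` in the currency of `X12.O11.inertTamagawaProductThree` (places `w` of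
`K` with `f(w | ℚ) = 2`):

* `fibre_eq_singleton_of_inertiaDeg_eq_two` — a place `w` with `f = 2` is the ONLY place above
  `v = w ∩ 𝓞 ℚ` and has `e = 1` (the tree's `placesOver_trichotomy_of_finrank_eq_two`);
* `natGenerator_of_inertiaDeg_eq_two` — its prime `ℓ` is `2` or `≡ 2 (mod 3)`, and `ℓ ≠ 3` (Dedekind:
  `e = 1` above `ℓ` forces `ℓ ∤ d_K`; at odd `ℓ` inert means `d_K = −3` is a non-residue, i.e.
  `ℓ ≡ 2 (mod 3)` by the tree's `isSquare_neg_three_iff`);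
* `exists_inertiaDeg_eq_two_of_prime` — conversely every prime `ℓ = 2` or `ℓ ≡ 2 (mod 3)`, `ℓ ≥ 5`,
  has exactly one place above it, with `e = 1`, `f = 2` (`2`: `d_K ≢ 1 (mod 8)`, tree
  `ncard_primesOver_two_eq_two_iff`; odd `ℓ`: the split dictionary would make `−3` a residue);
* `three_mem_asIdeal_iff` — `3 ∈ w` iff the prime under `w` is `3`.

References: [NeukirchANT1999] Ch. I (8.5), Ch. III (2.12); Marcus, *Number Fields*, Ch. 3 Thm. 25;
Hardy–Wright Thm. 96; tree files named above; HOME/ty3/CERT-TABLE-K12r.md §PART I.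
-/

noncomputable section

open scoped Classical NumberField
open NumberField IsDedekindDomain IsDedekindDomain.HeightOneSpectrum Rat.HeightOneSpectrum
  Literature.NumberTheory.EllipticCurves Literature.NumberTheory.GaloisRepresentations

namespace Summit.BirchSwinnertonDyer.Rank1Residual.X12.CMRamifiedRecords

section Places

variable {K : Type} [Field K] [NumberField K]

/-- The prime under `w ∩ 𝓞 ℚ`, read through `primesEquiv`, is `natGenerator`. [folklore] -/
theorem primesEquiv_val_eq_natGenerator (v : HeightOneSpectrum (𝓞 ℚ)) :
    (primesEquiv v : ℕ) = natGenerator v := rfl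

/-- **A place of inertia degree `2` of a quadratic field is alone above its prime and unramified**
(`#{w ∣ v} · e · f = 2`). [cite: NeukirchANT1999, Ch. I, Prop. (8.2)] -/
theorem fibre_eq_singleton_of_inertiaDeg_eq_two (h2 : Module.finrank ℚ K = 2)
    (w : HeightOneSpectrum (𝓞 K)) (hf : w.asIdeal.inertiaDeg (𝓞 ℚ) = 2) :
    {w' : HeightOneSpectrum (𝓞 K) | w'.under (𝓞 ℚ) = w.under (𝓞 ℚ)} = {w} ∧
      w.asIdeal.ramificationIdx (𝓞 ℚ) = 1 := by
  rcases placesOver_trichotomy_of_finrank_eq_two K h2 (w.under (𝓞 ℚ)) with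
    ⟨w₁, w₂, -, -, hall⟩ | ⟨w₀, hset, he, -⟩ | ⟨w₀, hset, -, hf1⟩
  · have := (hall w rfl).2; omega
  · have hw : w ∈ ({w₀} : Set (HeightOneSpectrum (𝓞 K))) := by rw [← hset]; exact rfl
    rw [Set.mem_singleton_iff] at hw
    subst hw
    exact ⟨hset, he⟩
  · have hw : w ∈ ({w₀} : Set (HeightOneSpectrum (𝓞 K))) := by rw [← hset]; exact rfl
    rw [Set.mem_singleton_iff] at hw
    subst hw
    omega

/-- **The prime under a place of inertia degree `2` of `ℚ(√−3)` is `2` or `≡ 2 (mod 3)`, and is not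
`3`**: `e = 1` with a single place above `ℓ` gives `ℓ ∤ d_K = −3` (Dedekind), so `ℓ ≠ 3`; at an odd `ℓ`
the inert dictionary says `d_K = −3` is a NON-residue mod `ℓ`, i.e. `ℓ ≢ 1 (mod 6)` (Hardy–Wright
Thm. 96, tree `isSquare_neg_three_iff`). [cite: NeukirchANT1999, Ch. I, Prop. (8.5)] -/
theorem natGenerator_of_inertiaDeg_eq_two (h2 : Module.finrank ℚ K = 2) (hd : NumberField.discr K = -3)
    (w : HeightOneSpectrum (𝓞 K)) (hf : w.asIdeal.inertiaDeg (𝓞 ℚ) = 2) :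
    natGenerator (w.under (𝓞 ℚ)) ≠ 3 ∧
      (natGenerator (w.under (𝓞 ℚ)) = 2 ∨
        (5 ≤ natGenerator (w.under (𝓞 ℚ)) ∧ natGenerator (w.under (𝓞 ℚ)) % 3 = 2)) := by
  set v := w.under (𝓞 ℚ) with hvdef
  obtain ⟨hset, he⟩ := fibre_eq_singleton_of_inertiaDeg_eq_two h2 w hf
  have hℓ : (natGenerator v).Prime := prime_natGenerator v
  have hnd : ¬ ((primesEquiv v : ℕ) : ℤ) ∣ NumberField.discr K :=
    AdditivePotMult.not_dvd_discr_of_fibre_eq_singleton (K := K) (v := v) hset he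
  rw [primesEquiv_val_eq_natGenerator, hd] at hnd
  have hℓ3 : natGenerator v ≠ 3 := fun h => hnd (by rw [h]; norm_num)
  refine ⟨hℓ3, ?_⟩
  by_cases hℓ2 : natGenerator v = 2
  · exact Or.inl hℓ2
  · right
    have h5 : 5 ≤ natGenerator v := by
      have h2le := hℓ.two_le
      rcases (show natGenerator v = 2 ∨ natGenerator v = 3 ∨ natGenerator v = 4 ∨ 5 ≤ natGenerator v
        by omega) with h | h | h | h
      · exact absurd h hℓ2
      · exact absurd h hℓ3
      · exact absurd (h ▸ hℓ) (by decide)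
      · exact h
    refine ⟨h5, ?_⟩
    have hv2 : (primesEquiv v : ℕ) ≠ 2 := hℓ2
    obtain ⟨-, hnsq⟩ := AdditivePotMult.not_dvd_and_not_isSquare_discr_of_inert v h2 hv2 hset he
    rw [hd, primesEquiv_val_eq_natGenerator] at hnsq
    haveI : Fact (natGenerator v).Prime := ⟨hℓ⟩
    have hns : ¬ IsSquare (-3 : ZMod (natGenerator v)) := by exact_mod_cast hnsq
    rw [Literature.NumberTheory.Congruences.SmallQuadraticResidues.isSquare_neg_three_iff (by omega)]
      at hns
    -- a prime `≥ 5` is `≡ 1` or `5 (mod 6)`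
    have h6 : natGenerator v % 6 = 1 ∨ natGenerator v % 6 = 5 := by
      have h2' : ¬ 2 ∣ natGenerator v := fun h =>
        hℓ2 ((Nat.prime_dvd_prime_iff_eq Nat.prime_two hℓ).mp h).symm
      have h3' : ¬ 3 ∣ natGenerator v := fun h =>
        hℓ3 ((Nat.prime_dvd_prime_iff_eq Nat.prime_three hℓ).mp h).symm
      omega
    omega

/-- **Every prime `ℓ = 2` or `ℓ ≡ 2 (mod 3)`, `ℓ ≥ 5`, is INERT in `ℚ(√−3)`**: a single place above
it, with `e = 1`, `f = 2`. At `2`: `d_K = −3 ≢ 1 (mod 8)` excludes splitting (tree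
`ncard_primesOver_two_eq_two_iff`) and `2 ∤ d_K` excludes ramification; at odd `ℓ`: splitting would
make `−3` a residue (`ℓ ≡ 1 (mod 6)`), ramification would give `ℓ ∣ 3`.
[cite: NeukirchANT1999, Ch. I, Prop. (8.5)] -/
theorem exists_inertiaDeg_eq_two_of_prime (h2 : Module.finrank ℚ K = 2) (hd : NumberField.discr K = -3)
    {ℓ : ℕ} (hℓ : ℓ.Prime) (hℓ' : ℓ = 2 ∨ (5 ≤ ℓ ∧ ℓ % 3 = 2)) :
    ∃ w : HeightOneSpectrum (𝓞 K), natGenerator (w.under (𝓞 ℚ)) = ℓ ∧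
      {w' : HeightOneSpectrum (𝓞 K) | w'.under (𝓞 ℚ) = w.under (𝓞 ℚ)} = {w} ∧
      w.asIdeal.ramificationIdx (𝓞 ℚ) = 1 ∧ w.asIdeal.inertiaDeg (𝓞 ℚ) = 2 := by
  set v : HeightOneSpectrum (𝓞 ℚ) := (primesEquiv (R := 𝓞 ℚ)).symm ⟨ℓ, hℓ⟩ with hvdef
  have hvℓ : natGenerator v = ℓ := natGenerator_primesEquiv_symm_ringOfIntegers ⟨ℓ, hℓ⟩
  have hvℓ' : (primesEquiv v : ℕ) = ℓ := hvℓ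
  rcases placesOver_trichotomy_of_finrank_eq_two K h2 v with
    ⟨w₁, w₂, hne, hset, -⟩ | ⟨w₀, hset, he, hf⟩ | ⟨w₀, hset, he, -⟩
  · -- split: impossible
    exfalso
    rcases hℓ' with rfl | ⟨h5, h3⟩
    · have h := AdditivePotMult.ncard_primesOver_eq_of_fibre_pair K v hne hset
      rw [hvℓ'] at h
      have h8 := (Literature.NumberTheory.QuadraticFields.Quadratic.ncard_primesOver_two_eq_two_iff
        (K := K) h2).mp (by exact_mod_cast h)
      rw [hd] at h8
      norm_num at h8
    · have hv2 : (primesEquiv v : ℕ) ≠ 2 := by rw [hvℓ']; omega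
      obtain ⟨-, hsq⟩ := AdditivePotMult.not_dvd_and_isSquare_discr_of_split v h2 hv2 hne hset
      rw [hd, hvℓ'] at hsq
      haveI : Fact ℓ.Prime := ⟨hℓ⟩
      have hs : IsSquare (-3 : ZMod ℓ) := by exact_mod_cast hsq
      rw [Literature.NumberTheory.Congruences.SmallQuadraticResidues.isSquare_neg_three_iff (by omega)]
        at hs
      omega
  · -- inert
    have hw₀ : w₀.under (𝓞 ℚ) = v := by
      have : w₀ ∈ ({w₀} : Set (HeightOneSpectrum (𝓞 K))) := Set.mem_singleton _
      rw [← hset] at this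
      exact this
    refine ⟨w₀, by rw [hw₀, hvℓ], by rw [hw₀]; exact hset, he, hf⟩
  · -- ramified: impossible (`ℓ ∣ d_K = −3` forces `ℓ = 3`)
    exfalso
    have hw₀ : w₀.under (𝓞 ℚ) = v := by
      have : w₀ ∈ ({w₀} : Set (HeightOneSpectrum (𝓞 K))) := Set.mem_singleton _
      rw [← hset] at this
      exact this
    have hdvd := AdditivePotMult.natCast_dvd_discr_of_ramificationIdx_eq_two (K := K) (v := v) hw₀ he
    rw [hvℓ', hd] at hdvd
    have h3 : (ℓ : ℤ) ∣ 3 := by rwa [← dvd_neg]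
    have hℓ3 : ℓ ∣ 3 := by exact_mod_cast h3
    have := (Nat.prime_dvd_prime_iff_eq hℓ Nat.prime_three).mp hℓ3
    omega

/-- `3 ∈ w` iff the prime under `w` is `3`. [folklore] -/
theorem three_mem_asIdeal_iff (w : HeightOneSpectrum (𝓞 K)) :
    ((3 : ℕ) : 𝓞 K) ∈ w.asIdeal ↔ natGenerator (w.under (𝓞 ℚ)) = 3 := by
  have h : ((3 : ℕ) : 𝓞 K) ∈ w.asIdeal ↔ ((3 : ℕ) : 𝓞 ℚ) ∈ (w.under (𝓞 ℚ)).asIdeal := by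
    rw [show (w.under (𝓞 ℚ)).asIdeal = w.asIdeal.comap (algebraMap (𝓞 ℚ) (𝓞 K)) from rfl,
      Ideal.mem_comap, map_natCast]
  rw [h, Rat.natCast_mem_asIdeal_iff,
    Nat.prime_dvd_prime_iff_eq (prime_natGenerator _) Nat.prime_three]

end Places

end Summit.BirchSwinnertonDyer.Rank1Residual.X12.CMRamifiedRecords

end
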